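import Summits.HodgeConjecture.CorCM.MultiFieldWeilCoprimeOneMember
import Summits.HodgeConjecture.CorCM.MultiFieldWeilFrames
import Literature.AlgebraicGeometry.ComplexMultiplication.PrimitiveCMTypeSimple
import HarnessLib

/-!
# MULTI-FIELD WEIL ENGINE — SEXTIC SIMPLICITY IS AUTOMATIC: every CM abelian threefold `B ⊨ (K; Φ)` whose sextic CM field contains the imaginary quadratic field `k` and
# whose type has `k`-signature `(1,2)` is SIMPLE

Cell `pub-hodgecm2` (COR-CM), seat b30 gen 41 (2026-08-26); count-neutral own lane MULTI-FIELD WEIL ENGINE (stem `MultiFieldWeil*`).  Every headline of the sextic part of the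
menu (gens 31–41: «up to two SIMPLE CM threefolds per sextic field», binder `hS`) asks the user for simplicity; here it is PROVED from the normalisation of the type alone.
Theorems only; no definition, no named fact, no `sorry`.  HONEST FRAMING: Shimura's primitivity criterion in the tree's `Aut(ℂ)`-form
(`isSimple_of_isCMTypeRealisation_of_primitive`) plus transitivity of `Aut(ℂ/τ(k))` on the `τ`-embeddings; `HC_CM` is NOT touched.

**`isSimple_of_sextic_of_card_filter_eq_one`.**  `k` imaginary quadratic with `τ`, `K ⊇ i(k)` a sextic CM field, `B ⊨ (K; Φ)` a realisation read on `H¹` with EXACTLY ONE member of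
`Φ` over `τ` (`k`-signature `(1,2)`): then `B` is SIMPLE.  (With TWO members over `τ` apply it to `τ̄`, over which there is one.)
PROOF.  By Shimura §8.2 Prop. 26 (tree: `isSimple_of_isCMTypeRealisation_of_primitive`) it suffices that two embeddings `s, t : K → ℂ` with `ρ ∘ s ∈ Φ ⟺ ρ ∘ t ∈ Φ` for every
`ρ ∈ Aut(ℂ)` coincide.  Read `Hom(K, ℂ)` through a sign frame (`exists_signFrame`): the three `τ`-embeddings `x₀, x₁, x₂` and their conjugates `x̄_a`; `Φ = {x_p} ∪ {x̄_a : a ≠ p}`.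
Since `K` is CM, `ρ ∘ x̄_a = \overline{ρ ∘ x_a}` (`comp_conjugate_eq_conjugate_comp`), so an automorphism `ρ` fixing `τ` acts on both fibres by ONE injection `a ↦ pos_ρ(a)`, with
`ρ x_a ∈ Φ ⟺ pos_ρ(a) = p` and `ρ x̄_a ∈ Φ ⟺ pos_ρ(a) ≠ p`; and `Aut(ℂ/τ(k))` moves any `x_a` to `x_p` (`ZarhinLie.exists_ringEquiv_complex_comp_eq`).  Two distinct `τ`-embeddings are
separated by `ρ` with `ρ x_a = x_p`; two distinct `τ̄`-embeddings likewise; `x_a` and `x̄_b` by `ρ` with `ρ x_a = x_p` (`a = b`) or `ρ x_c = x_p` for the third letter `c` (`a ≠ b`).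
(Conceptually: the only proper CM subfield of a sextic CM field through `k` is `k` itself, and a type induced from `k` has `k`-signature `(3,0)` or `(0,3)`.)
USE: discharges the binder `hS` of `hodgeConjectureFor_biproduct_sigma_intermediate_of_shapes` (D9) and of every earlier sextic headline from `hcnt` alone.
[cite: Shimura1998, §8.2 Prop. 26 (p. 61) and §18.2 Lemma (i)] [cite: Lang2002, VI §1 Thm. 1.1 and Cor. 1.6] [cite: MilneCM2006, Ch. I §5 Prop. 5.2]

## References
* [Shimura1998] G. Shimura, *Abelian varieties with complex multiplication and modular functions*, §8.2 Prop. 26, §18.2.  [Lang2002] S. Lang, *Algebra*, GTM 211, VI §1.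
  [MilneCM2006] J. S. Milne, *Complex Multiplication* (2006), Ch. I §5.
-/

noncomputable section

open CategoryTheory NumberField

namespace Summit.HodgeConjecture.CorCM.MultiFieldWeil

open Finset
open Literature.AlgebraicGeometry Literature.AlgebraicGeometry.Motives Literature.AlgebraicGeometry.HodgeTheory
open Literature.AlgebraicGeometry.ComplexMultiplication (IsCMTypeRealisation isSimple_of_isCMTypeRealisation_of_primitive)
open Literature.AlgebraicTopology.SingularHomology

open scoped Classical

section Sextic

variable {K : Type} [Field K] [NumberField K] [IsCMField K] {k : Type} [Field k] [NumberField k] [IsCMField k]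

/-- On a CM field an automorphism of `ℂ` commutes with conjugation of embeddings: `ρ ∘ s̄ = \overline{ρ ∘ s}`. [cite: Shimura1998, §18.2 Lemma (i)] -/
theorem comp_conjugate_eq_conjugate_comp (ρ : ℂ ≃+* ℂ) (s : K →+* ℂ) :
    (ρ : ℂ →+* ℂ).comp (ComplexEmbedding.conjugate s) = ComplexEmbedding.conjugate ((ρ : ℂ →+* ℂ).comp s) := by
  refine RingHom.ext fun x => ?_
  show ρ (ComplexEmbedding.conjugate s x) = ComplexEmbedding.conjugate ((ρ : ℂ →+* ℂ).comp s) x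
  rw [ComplexEmbedding.conjugate_coe_eq, ComplexEmbedding.conjugate_coe_eq, ← IsCMField.complexEmbedding_complexConj K s x,
    ← IsCMField.complexEmbedding_complexConj K ((ρ : ℂ →+* ℂ).comp s) x]
  rfl

/-- **A CM THREEFOLD OVER A SEXTIC CM FIELD THROUGH `k` WITH ONE TYPE MEMBER OVER `τ` IS SIMPLE.**  See the module docstring. [cite: Shimura1998, §8.2 Prop. 26 (p. 61) and §18.2 Lemma (i)]
[cite: Lang2002, VI §1 Thm. 1.1 and Cor. 1.6] -/
theorem isSimple_of_sextic_of_card_filter_eq_one (h6 : Module.finrank ℚ K = 6) (h2 : Module.finrank ℚ k = 2) (i : k →+* K) (τ : k →+* ℂ)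
    {Φ : CMType K} {A : AbelianVariety ℂ} {ι : 𝓞 K →+* End A} {θ : K →+* Module.End ℂ (complexBetti A.X 1)} (hA : IsCMTypeRealisation Φ A ι θ)
    (hone : (Finset.univ.filter fun s : K →+* ℂ => s.comp i = τ ∧ s ∈ Φ.1).card = 1) : A.IsSimple := by
  have hττ : ComplexEmbedding.conjugate τ ≠ τ := QuarticCM.conjugate_ne τ
  have hk : ∀ σ : k →+* ℂ, σ = τ ∨ σ = ComplexEmbedding.conjugate τ := fun σ => QuarticCM.eq_or_eq_conjugate_of_quadratic h2 τ σ
  obtain ⟨e, he_sign, he_conj⟩ := exists_signFrame (n := 3) (by rw [h6]) h2 i hττ hk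
  -- the position set `P = {p}` and the reading of `Φ`
  set P : Finset (Fin 3) := Finset.univ.filter fun a : Fin 3 => e.symm (a, true) ∈ Φ.1 with hP
  have hΦ : ∀ s : K →+* ℂ, s ∈ Φ.1 ↔ (e s).2 = decide ((e s).1 ∈ P) := fun s => mem_iff_snd_eq_decide_mem_posSet he_conj Φ s
  obtain ⟨p, hPp⟩ : ∃ p, P = {p} := Finset.card_eq_one.1 ((card_posSet he_sign Φ).trans hone)
  have hmemP : ∀ a, a ∈ P ↔ a = p := fun a => by rw [hPp, Finset.mem_singleton]
  -- the `τ`-embeddings `X a` and their conjugates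
  set X : Fin 3 → (K →+* ℂ) := fun a => e.symm (a, true) with hX
  have hXi : ∀ a, (X a).comp i = τ := fun a => (he_sign _).1 (by simp only [hX, Equiv.apply_symm_apply])
  have heconj : ∀ a, e (ComplexEmbedding.conjugate (X a)) = (a, false) := fun a => by rw [he_conj]; simp only [hX, Equiv.apply_symm_apply, Bool.not_true]
  -- transitivity of `Aut(ℂ/τ(k))` on the `τ`-embeddings
  haveI : Countable K := Countable.of_equiv _ (Module.finBasis ℚ K).equivFun.toEquiv.symm
  have htrans : ∀ a b : Fin 3, ∃ ρ : ℂ ≃+* ℂ, (ρ : ℂ →+* ℂ).comp τ = τ ∧ (ρ : ℂ →+* ℂ).comp (X a) = X b := by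
    intro a b
    obtain ⟨ρ, hρ⟩ := ZarhinLie.exists_ringEquiv_complex_comp_eq (X a) (X b)
    have hab : (ρ : ℂ →+* ℂ).comp (X a) = X b := RingHom.ext fun z => hρ z
    refine ⟨ρ, ?_, hab⟩
    calc (ρ : ℂ →+* ℂ).comp τ = ((ρ : ℂ →+* ℂ).comp (X a)).comp i := by rw [RingHom.comp_assoc, hXi a]
      _ = τ := by rw [hab, hXi b]
  -- for `ρ` fixing `τ`: `ρ ∘ X a` is over `τ`, at an injective position
  have hover : ∀ ρ : ℂ ≃+* ℂ, (ρ : ℂ →+* ℂ).comp τ = τ → ∀ a, (e ((ρ : ℂ →+* ℂ).comp (X a))).2 = true := fun ρ hρ a =>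
    (he_sign _).2 (by rw [RingHom.comp_assoc, hXi a, hρ])
  have hinj : ∀ ρ : ℂ ≃+* ℂ, (ρ : ℂ →+* ℂ).comp τ = τ → ∀ a b, (e ((ρ : ℂ →+* ℂ).comp (X a))).1 = (e ((ρ : ℂ →+* ℂ).comp (X b))).1 → a = b := by
    intro ρ hρ a b hab
    have h1 : e ((ρ : ℂ →+* ℂ).comp (X a)) = e ((ρ : ℂ →+* ℂ).comp (X b)) := Prod.ext hab (by rw [hover ρ hρ a, hover ρ hρ b])
    have h2 : (ρ : ℂ →+* ℂ).comp (X a) = (ρ : ℂ →+* ℂ).comp (X b) := e.injective h1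
    have h3 : X a = X b := RingHom.ext fun z => ρ.injective (RingHom.congr_fun h2 z)
    simpa only [hX, Equiv.apply_eq_iff_eq, Prod.mk.injEq, and_true] using e.symm.injective h3
  have hpos_eq : ∀ ρ : ℂ ≃+* ℂ, ∀ a b, (ρ : ℂ →+* ℂ).comp (X a) = X b → (e ((ρ : ℂ →+* ℂ).comp (X a))).1 = b := fun ρ a b h => by
    rw [h]; simp only [hX, Equiv.apply_symm_apply]
  -- membership of `ρ ∘ X a` and of `ρ ∘ X̄ a`
  have hmemX : ∀ ρ : ℂ ≃+* ℂ, (ρ : ℂ →+* ℂ).comp τ = τ → ∀ a, (ρ : ℂ →+* ℂ).comp (X a) ∈ Φ.1 ↔ (e ((ρ : ℂ →+* ℂ).comp (X a))).1 = p := by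
    intro ρ hρ a
    rw [hΦ, hover ρ hρ a, ← hmemP]
    exact ⟨fun h => of_decide_eq_true h.symm, fun h => (decide_eq_true h).symm⟩
  have hmemY : ∀ ρ : ℂ ≃+* ℂ, (ρ : ℂ →+* ℂ).comp τ = τ → ∀ a,
      (ρ : ℂ →+* ℂ).comp (ComplexEmbedding.conjugate (X a)) ∈ Φ.1 ↔ (e ((ρ : ℂ →+* ℂ).comp (X a))).1 ≠ p := by
    intro ρ hρ a
    rw [comp_conjugate_eq_conjugate_comp, hΦ, he_conj, hover ρ hρ a]
    simp only [hmemP, Bool.not_true]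
    exact ⟨fun h => of_decide_eq_false h.symm, fun h => (decide_eq_false h).symm⟩
  -- every embedding is some `X a` or some `X̄ a`
  have hcases : ∀ s : K →+* ℂ, ∃ a, s = X a ∨ s = ComplexEmbedding.conjugate (X a) := by
    intro s
    refine ⟨(e s).1, ?_⟩
    rcases hb : (e s).2 with _ | _
    · right
      apply e.injective
      rw [heconj, ← hb]
    · left
      apply e.injective
      simp only [hX, Equiv.apply_symm_apply, ← hb]
  -- the three separations
  have hXY : ∀ a b, (∀ ρ : ℂ ≃+* ℂ, (ρ : ℂ →+* ℂ).comp (X a) ∈ Φ.1 ↔ (ρ : ℂ →+* ℂ).comp (ComplexEmbedding.conjugate (X b)) ∈ Φ.1) → False := by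
    intro a b hst
    by_cases hab : a = b
    · subst hab
      obtain ⟨ρ, hρτ, hρa⟩ := htrans a p
      have h1 : (e ((ρ : ℂ →+* ℂ).comp (X a))).1 = p := hpos_eq ρ a p hρa
      exact (hmemY ρ hρτ a).1 ((hst ρ).1 ((hmemX ρ hρτ a).2 h1)) h1
    · obtain ⟨c, hc⟩ : ∃ c : Fin 3, c ∈ (Finset.univ.erase a).erase b :=
        Finset.card_pos.1 (by rw [Finset.card_erase_of_mem (Finset.mem_erase.2 ⟨Ne.symm hab, Finset.mem_univ b⟩), Finset.card_erase_of_mem (Finset.mem_univ a)]; simp)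
      have hcb : c ≠ b := Finset.ne_of_mem_erase hc
      have hca : c ≠ a := Finset.ne_of_mem_erase (Finset.mem_of_mem_erase hc)
      obtain ⟨ρ, hρτ, hρc⟩ := htrans c p
      have hc1 : (e ((ρ : ℂ →+* ℂ).comp (X c))).1 = p := hpos_eq ρ c p hρc
      have ha1 : (e ((ρ : ℂ →+* ℂ).comp (X a))).1 ≠ p := fun h => hca (hinj ρ hρτ c a (hc1.trans h.symm))
      have hb1 : (e ((ρ : ℂ →+* ℂ).comp (X b))).1 ≠ p := fun h => hcb (hinj ρ hρτ c b (hc1.trans h.symm))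
      exact ha1 ((hmemX ρ hρτ a).1 ((hst ρ).2 ((hmemY ρ hρτ b).2 hb1)))
  refine isSimple_of_isCMTypeRealisation_of_primitive hA fun s t hst => ?_
  obtain ⟨a, hs⟩ := hcases s
  obtain ⟨b, ht⟩ := hcases t
  rcases hs with rfl | rfl <;> rcases ht with rfl | rfl
  · -- two `τ`-embeddings
    by_contra hne
    have hab : a ≠ b := fun h => hne (by rw [h])
    obtain ⟨ρ, hρτ, hρa⟩ := htrans a p
    have ha1 : (e ((ρ : ℂ →+* ℂ).comp (X a))).1 = p := hpos_eq ρ a p hρa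
    have hb1 : (e ((ρ : ℂ →+* ℂ).comp (X b))).1 ≠ p := fun h => hab (hinj ρ hρτ a b (ha1.trans h.symm))
    exact hb1 ((hmemX ρ hρτ b).1 ((hst ρ).1 ((hmemX ρ hρτ a).2 ha1)))
  · exact (hXY a b hst).elim
  · exact (hXY b a fun ρ => (hst ρ).symm).elim
  · -- two `τ̄`-embeddings
    by_contra hne
    have hab : a ≠ b := fun h => hne (by rw [h])
    obtain ⟨ρ, hρτ, hρa⟩ := htrans a p
    have ha1 : (e ((ρ : ℂ →+* ℂ).comp (X a))).1 = p := hpos_eq ρ a p hρa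
    have hb1 : (e ((ρ : ℂ →+* ℂ).comp (X b))).1 ≠ p := fun h => hab (hinj ρ hρτ a b (ha1.trans h.symm))
    exact (hmemY ρ hρτ a).1 ((hst ρ).2 ((hmemY ρ hρτ b).2 hb1)) ha1

end Sextic

end Summit.HodgeConjecture.CorCM.MultiFieldWeil

end
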